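import Summits.ResolutionOfSingularities.ResolutionOfSingularities.Theorems.EquisingularLiftEquisingularLiftNatTowerConeRoundOldThree
import Summits.ResolutionOfSingularities.ResolutionOfSingularities.Theorems.EquisingularLiftEquisingularLiftNatTowerBPointSteps
import Summits.ResolutionOfSingularities.ResolutionOfSingularities.Theorems.EquisingularLiftEquisingularLiftNatTowerInvBDefs
import Summits.ResolutionOfSingularities.ResolutionOfSingularities.Theorems.EquisingularLiftEquisingularLiftNatTowerRoundBDefs
import HarnessLib

/-!
# [OURS · L1 W4.5(b) · EL♮(3)] T23-A ENGINE — THE CONE-WITNESSED ROUND ON `Tower.InvB`, CORE (explicit stage, retained list)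
# (rung `stub_elnat_defTowerBPointResolutionThree`, TWENTY-SIXTH registration; Defs …NatTowerRoundBDefs p601799 / …NatTowerInvBDefs p602188)

res-L1-w45b-stub-4 g10 (T23-A ENGINE OWNER; word `L/res-L1-w45b-stub-4/T23A-ENGINE-WORD.md` 340f00d84dbcbbfc). Crux EL♮(3) = stmt-ResolutionOfSingularities-20148
(parent stmt-…-20038), route `EquisingularLift`, line `sections`. OURS; NOT a statement of any manuscript; AI-written, weaker than expert review. DEF-FREE;
no `sorry`; standard axioms; `--supports stmt-ResolutionOfSingularities-20148 --as helper`.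

WHAT. `Tower.invB_coneRoundCore` = res-D-pv-029's / res-L1-w45b-stub-4's `Tower.inv₃_coneRound_new` (…NatTowerConeRoundThree) AND `Tower.inv₃_coneRound_old`
(…NatTowerConeRoundOldThree) MERGED INTO ONE EXPLICIT STAGE and extended by the retained list (the cone twin of `Tower.invB_embRoundCore`,
…NatTowerBEmbRoundCore): the host is the RUNNING surface `E` with its cone shadow `K` (cone rounds are never hosted by a retained member — `TowerRoundB`'s
second disjunct is Čech-only), the centre is the shadow pair `𝓔 ⊔ 𝒦` (exact trace `Z = E ∩ closure K` by `ConeWitness`), blown up ONCE; in that new stage the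
NEW surface `υ₂⁻¹Z` (datum born `hRuledBorn`, cone `St 𝒦`), the OLD surface `closure υ₂⁻¹(E ∖ Z)` (`≅`, `hRuledIso`; disjoint from `St 𝒦`), and every
`F' ∈ Es'` with `RoundTransportOK υ₂ Z E F F'` from the shadow-forgotten candidates `Cs` (F = E ↦ old surface with `∅`; `Disjoint Z F` ↦ B-AWAY) ⇒
`Tower.InvB` at the new stage for `E' ∈ {υ₂⁻¹Z, closure υ₂⁻¹(E ∖ Z)}` and `K' = ∅ ∨ K' = closure υ₂⁻¹(K ∖ Z)`. Binder shapes of `hRuledBorn` = 029's `hRuled` of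
`_new` VERBATIM; `hEZ` = the `_old` stand-in (discharged by `Tower.subset_closure_diff_of_inv₃_coneWitness`). Proof = the two ₆ proofs merged (adapted copy)
+ B-AWAY.
-/

set_option linter.dupNamespace false -- mandated namespace `Summit.<Summit>.<Problem>` of this single-conjunct summit

noncomputable section

open CategoryTheory CategoryTheory.Limits AlgebraicGeometry TopologicalSpace Topology IsLocalRing
open Literature.AlgebraicGeometry.Resolution
open AlgebraicGeometry.Scheme.IdealSheafData
open Summit.ResolutionOfSingularities.ResolutionOfSingularities.Theses.EquisingularLift.Split
open Summit.ResolutionOfSingularities.ResolutionOfSingularities.Cruxes.EquisingularLift.StrataSplit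
open scoped nonZeroDivisors

namespace Summit.ResolutionOfSingularities.ResolutionOfSingularities.Cruxes.EquisingularLiftNat.Sections

set_option maxHeartbeats 800000 in -- one large assembly over a 20-clause invariant (as in the ₆ files)
/-- **The cone-witnessed round on `Tower.InvB`, core at ONE explicit new stage** (module docstring). [cite: GortzWedhorn2020, (13.19) and Prop. 13.91]
[cite: Liu2002, Thm. 8.1.19] [OURS · L1 W4.5b · T23-A engine] clause (round, cone-witnessed) of the B-driver toward `stub_elnat_defTowerBPointResolutionThree`
(stmt-ResolutionOfSingularities-20148 / -20038); NOT a statement of the manuscript. -/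
theorem Tower.invB_coneRoundCore (O : Type) [CommRing O] [IsDomain O] [IsDiscreteValuationRing O] (k : Type) [Field k]
    (θ : O →+* k) (hθ : Function.Surjective θ)
    (P : Scheme.{0}) (q : P ⟶ Spec (.of O)) [IsProper q] (Y : Set P) (hYirr : IsIrreducible Y) (hYcl : IsClosed Y)
    (hPnoeth : IsLocallyNoetherian P) (hPreg : Scheme.IsRegular P)
    (Ch : ∀ X' : Scheme.{0}, (X' ⟶ P) → Set X' → Prop)
    (hChain : ∀ (X' : Scheme.{0}) (σ : X' ⟶ P) (S : Set X'), Ch X' σ S → Chain P Y X' σ S)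
    (hStep : ∀ (X' X'' : Scheme.{0}) (σ' : X' ⟶ P) (S' : Set X') (C : X'.IdealSheafData) (τ : X'' ⟶ X'),
      Ch X' σ' S' → IsBlowup τ C → Scheme.IsRegular C.subscheme → Flat (C.subschemeι ≫ σ' ≫ q) →
      σ' '' (C.support : Set X') ⊆ {x : P | ¬ IsGenericPoint x Y} →
      (C.support : Set X') ∩ (σ' ≫ q) ⁻¹' {IsLocalRing.closedPoint O} ⊆ S' →
      Ch X'' (τ ≫ σ') (closure (τ ⁻¹' (S' \ (C.support : Set X')))))
    (Ruled : Tower.RuledDatum P)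
    {F₉ : Scheme.{0}} (Z₉ : Set F₉) (hZ₉ : IsClosed Z₉) {F₁₀ : Scheme.{0}} (υ' : F₁₀ ⟶ F₉)
    (hRuledIso : ∀ (G₀ G₀' : Scheme.{0}) (γ₀ : G₀ ⟶ F₁₀) (γ₀' : G₀' ⟶ F₁₀) (E₀ : Set G₀) (E₀' : Set G₀') (X₀ X₀'' : Scheme.{0})
        (σ₀ : X₀ ⟶ P) (j₀ : G₀ ⟶ X₀) (j₀' : G₀' ⟶ X₀'') (𝓔₀ : X₀.IdealSheafData) (𝓔₀' : X₀''.IdealSheafData) (τ₀ : X₀'' ⟶ X₀),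
      (∃ e : 𝓔₀'.subscheme ≅ 𝓔₀.subscheme, e.hom ≫ 𝓔₀.subschemeι = 𝓔₀'.subschemeι ≫ τ₀) →
      Ruled F₉ Z₉ hZ₉ F₁₀ υ' G₀ γ₀ E₀ X₀ σ₀ j₀ 𝓔₀ → Ruled F₉ Z₉ hZ₉ F₁₀ υ' G₀' γ₀' E₀' X₀'' (τ₀ ≫ σ₀) j₀' 𝓔₀')
    (G G' : Scheme.{0}) (γ : G ⟶ F₁₀) (T E K : Set G) (Cs : List (Set G)) (hE : IsClosed E) (Z : Set G) (hZ : IsClosed Z)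
    (υ₂ : G' ⟶ G)
    -- the old invariant, UNPACKED at its stage, with the running surface's datum and the shadow-forgotten candidates
    (hυ' : IsBlowup υ' (vanishingIdeal (⟨Z₉, hZ₉⟩ : Closeds F₉))) (hZinf : Z₉.Infinite) [IsIntegral G]
    (hTirr : IsIrreducible T) (hTE₀ : ¬ T ⊆ E)
    (X : Scheme.{0}) (σ : X ⟶ P) (S : Set X) (jG : G ⟶ X) (tG : G ⟶ Spec (.of k))
    (hCh : Ch X σ S) [IsIntegral X] [IsLocallyNoetherian X] (hXreg : Scheme.IsRegular X) (hdom : IsDominant (σ ≫ q))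
    (hsq : IsPullback jG tG (σ ≫ q) (Spec.map (CommRingCat.ofHom θ))) (hTS : jG '' T = S)
    (hExcE : Tower.Exc₃ O P q Y Ruled Z₉ hZ₉ υ' G γ E hE K X σ jG)
    (hCand : ∀ F ∈ Cs, ∃ hF : IsClosed F, ¬ T ⊆ F ∧ Tower.Exc₃ O P q Y Ruled Z₉ hZ₉ υ' G γ F hF ∅ X σ jG)
    -- the round
    (hZET : Z ⊆ E ∩ T) (hZne : Z.Nonempty) (hfull : TowerFull F₉ F₁₀ υ' Z₉ hZ₉ G γ Z hZ) (hcone : ConeWitness G E hE K Z hZ)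
    (hυ₂ : IsBlowup υ₂ (vanishingIdeal ⟨Z, hZ⟩))
    (hKcl : IsClosed K) (hKE : K ⊆ closure (K \ E)) (hKne : K ≠ Set.univ) (hEZ : E ⊆ closure (E \ Z))
    -- BIRTH of the datum for the NEW surface (029's `hRuled` of `_new` verbatim)
    (hRuledBorn : ∀ (X : Scheme.{0}) (σ : X ⟶ P) (S : Set X) (jG : G ⟶ X) (tG : G ⟶ Spec (.of k)) (𝓔 𝒦 : X.IdealSheafData)
        (X'' : Scheme.{0}) (τ : X'' ⟶ X) (j₂ : G' ⟶ X'') (t₂ : G' ⟶ Spec (.of k)),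
        Ch X σ S → IsIntegral X → IsLocallyNoetherian X → Scheme.IsRegular X → IsDominant (σ ≫ q) →
        IsPullback jG tG (σ ≫ q) (Spec.map (CommRingCat.ofHom θ)) → jG '' T = S →
        (𝓔 ⊔ 𝒦).comap jG = vanishingIdeal ⟨Z, hZ⟩ → Flat ((𝓔 ⊔ 𝒦).subschemeι ≫ σ ≫ q) → Scheme.IsRegular (𝓔 ⊔ 𝒦).subscheme →
        Scheme.IsRegular 𝓔.subscheme → IsBlowup τ (𝓔 ⊔ 𝒦) → IsPullback j₂ t₂ ((τ ≫ σ) ≫ q) (Spec.map (CommRingCat.ofHom θ)) →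
        j₂ ≫ τ = υ₂ ≫ jG →
        Ruled F₉ Z₉ hZ₉ F₁₀ υ' G' (υ₂ ≫ γ) (υ₂ ⁻¹' Z) X'' (τ ≫ σ) j₂ ((𝓔 ⊔ 𝒦).comap τ))
    -- the producer's menus
    (K' E' : Set G') (Es' : List (Set G'))
    (hK' : K' = ∅ ∨ K' = closure (υ₂ ⁻¹' (K \ Z)))
    (hE' : E' = υ₂ ⁻¹' Z ∨ E' = closure (υ₂ ⁻¹' (E \ Z)))
    (hEs' : ∀ F' ∈ Es', ∃ F ∈ Cs, RoundTransportOK υ₂ Z E F F') :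
    Tower.InvB O k θ P q Y Ch Ruled F₉ Z₉ hZ₉ F₁₀ υ' G' (υ₂ ≫ γ) (closure (υ₂ ⁻¹' (T \ Z))) E' Es' K' := by
  classical
  have hZE : Z ⊆ E := fun z hz => (hZET hz).1
  have hZT : Z ⊆ T := fun z hz => (hZET hz).2
  rcases hExcE with hno | ⟨𝓔, he_i, he_ii, he_iii, he_iv, he_v, hshadow⟩
  · exact absurd hfull (Tower.not_towerFull_of_noRound υ' Z₉ hZ₉ hZinf G γ E hno Z hZ hZE)
  obtain ⟨hZeq, hwit⟩ := hcone
  rcases hshadow with hK0 | ⟨𝒦, hk_i, ⟨V, hEV, hk_ii⟩, hk_iii, hk_iv, hk_v, hk_vi⟩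
  · exfalso
    rw [hK0, closure_empty, Set.inter_empty] at hZeq
    exact hZne.ne_empty hZeq
  -- properness of the stage; the model square
  obtain ⟨-, -, hσ⟩ := chain_isRegular P Y X σ S (hChain _ _ _ hCh) hPnoeth hPreg
  haveI := hσ
  haveI : IsProper (σ ≫ q) := inferInstance
  haveI : IsClosedImmersion (Spec.map (CommRingCat.ofHom θ)) := IsClosedImmersion.spec_of_surjective _ hθ
  haveI hjci : IsClosedImmersion jG := MorphismProperty.IsStableUnderBaseChange.of_isPullback hsq.flip inferInstance
  haveI : IsLocallyNoetherian G := LocallyOfFiniteType.isLocallyNoetherian jG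
  have hjsp : ∀ z : G, (σ ≫ q) (jG z) = closedPoint O := fun z => by
    have h1 : jG z ∈ Set.range jG := ⟨z, rfl⟩
    rw [range_eq_preimage_of_isPullback hsq, range_specMap_of_surjective_of_field θ hθ] at h1
    exact h1
  have hrangej : Set.range jG = (σ ≫ q) ⁻¹' {closedPoint O} := by
    rw [range_eq_preimage_of_isPullback hsq, range_specMap_of_surjective_of_field θ hθ]
  -- the centre `𝒞 := 𝓔 ⊔ 𝒦`: exact trace `𝓘⟨Z⟩` (the cone witness), flat (k-iii), regular, off the generic point
  have hCD : (𝓔 ⊔ 𝒦).comap jG = vanishingIdeal ⟨Z, hZ⟩ := by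
    rw [comap_sup_eq_vanishingIdeal_sup_of_loc jG 𝓔 𝒦 hE he_i V hEV hk_ii, hwit]
  have hZEK : (⟨E ∩ closure K, hE.inter isClosed_closure⟩ : Closeds G) = ⟨Z, hZ⟩ := Closeds.ext hZeq.symm
  have hCreg_pt : ∀ x ∈ ((𝓔 ⊔ 𝒦).support : Set X), (σ ≫ q) x = closedPoint O →
      IsRegularLocalRing (X.presheaf.stalk x ⧸ stalkIdeal (𝓔 ⊔ 𝒦) x) := by
    intro x hx hqx
    obtain ⟨y, rfl⟩ : x ∈ Set.range jG := by rw [hrangej]; exact hqx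
    refine hk_iv y hx ?_
    rw [hZEK, hwit]
  haveI : IsProper ((𝓔 ⊔ 𝒦).subschemeι ≫ σ ≫ q) := inferInstance
  have hCreg : Scheme.IsRegular (𝓔 ⊔ 𝒦).subscheme :=
    Scheme.isRegular_subscheme_of_forall_over_closedPoint (σ ≫ q) (𝓔 ⊔ 𝒦) fun x hx hqx => hCreg_pt x hx hqx
  have hiv : σ '' ((𝓔 ⊔ 𝒦).support : Set X) ⊆ {p : P | ¬ IsGenericPoint p Y} := by
    rintro _ ⟨x, hx, rfl⟩
    exact he_iv ⟨x, Scheme.IdealSheafData.support_antitone le_sup_left hx, rfl⟩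
  -- support bookkeeping downstairs
  have hsuppZ : ((vanishingIdeal ⟨Z, hZ⟩ : G.IdealSheafData).support : Set G) = Z := Scheme.IdealSheafData.coe_support_vanishingIdeal _
  have hDT : ((vanishingIdeal ⟨Z, hZ⟩ : G.IdealSheafData).support : Set G) ⊆ T := by rw [hsuppZ]; exact hZT
  have hTZ : ¬ T ⊆ Z := fun h => hTE₀ (h.trans hZE)
  have hTD : ¬ T ⊆ ((vanishingIdeal ⟨Z, hZ⟩ : G.IdealSheafData).support : Set G) := by rw [hsuppZ]; exact hTZ
  -- blow up the centre ONCE and run the model step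
  obtain ⟨X₂, τ, hτ⟩ := exists_isBlowup X (𝓔 ⊔ 𝒦)
  obtain ⟨hint₂, hnoeth₂, hreg₂, hdom₂, hF₂, hirr, j₂, t₂, hsq₂, hcomm, hCh₂⟩ :=
    modelStep_chain O k θ hθ P q Y hYirr hYcl Ch hChain hStep X σ S hCh hXreg hdom G jG tG hsq T hTS (𝓔 ⊔ 𝒦)
      (vanishingIdeal ⟨Z, hZ⟩) hCD hCreg hk_iii hiv hDT hTD X₂ τ hτ G' υ₂ hυ₂
  rw [hsuppZ] at hirr hCh₂
  haveI := hint₂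
  haveI := hnoeth₂
  haveI := hF₂
  haveI : IsProper τ := hτ.isProper
  have hcart : IsPullback j₂ υ₂ τ jG := isPullback_of_model_squares θ hθ (σ ≫ q) τ jG tG hsq j₂ t₂
    (by simpa only [Category.assoc] using hsq₂) υ₂ hcomm
  -- a point of `G'` off the exceptional surface, `T' ⊄ E'`, `T' ⊄ E''`, the centre is non-zero
  obtain ⟨t, htT, htE⟩ := Set.not_subset.mp hTE₀
  have htZ : t ∉ Z := fun h => htE (hZE h)
  obtain ⟨t', ht'⟩ := hυ₂.exists_preimage_of_not_mem_support (z := t) (by rw [hsuppZ]; exact htZ)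
  have hTEnew : ¬ closure (υ₂ ⁻¹' (T \ Z)) ⊆ υ₂ ⁻¹' Z := by
    intro h
    have h1 : t' ∈ closure (υ₂ ⁻¹' (T \ Z)) := subset_closure (show υ₂ t' ∈ T \ Z by rw [ht']; exact ⟨htT, htZ⟩)
    have h2 : υ₂ t' ∈ Z := h h1
    rw [ht'] at h2
    exact htZ h2
  have hTEold : ¬ closure (υ₂ ⁻¹' (T \ Z)) ⊆ closure (υ₂ ⁻¹' (E \ Z)) := by
    intro h
    have h1 : t' ∈ closure (υ₂ ⁻¹' (T \ Z)) := subset_closure (show υ₂ t' ∈ T \ Z by rw [ht']; exact ⟨htT, htZ⟩)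
    have h2 : t' ∈ υ₂ ⁻¹' E :=
      (closure_minimal (Set.preimage_mono fun x hx => hx.1) (hE.preimage υ₂.continuous)) (h h1)
    rw [Set.mem_preimage, ht'] at h2
    exact htE h2
  have hCne : 𝓔 ⊔ 𝒦 ≠ ⊥ := by
    rintro hbot
    obtain ⟨u, hu, hKu⟩ := hτ.isEffectiveCartier.exists_stalkIdeal_eq_span (j₂ t')
    rw [hbot, Scheme.IdealSheafData.comap_bot, stalkIdeal_bot, eq_comm, Ideal.span_singleton_eq_bot] at hKu
    rw [hKu] at hu
    exact zero_notMem_nonZeroDivisors hu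
  -- the centre's special points lie in `jG '' Z`
  have hCDpts : ((𝓔 ⊔ 𝒦).support : Set X) ∩ (σ ≫ q) ⁻¹' {closedPoint O} ⊆ jG '' Z := by
    rintro c ⟨hcC, hcsp⟩
    have hc : c ∈ Set.range jG := by rw [hrangej]; exact hcsp
    obtain ⟨g, rfl⟩ := hc
    refine ⟨g, ?_, rfl⟩
    have h1 : g ∈ (((𝓔 ⊔ 𝒦).comap jG).support : Set G) := by rw [support_comap]; exact hcC
    rw [hCD, hsuppZ] at h1
    exact h1
  -- ============ (i) the NEW exceptional surface `𝓔' := 𝒞·𝒪_{X₂}` with the cone `St 𝒦` ============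
  have hqr : ∀ z ∈ ((⟨Z, hZ⟩ : Closeds G) : Set G), ∃ (n : ℕ) (c : Fin n → X.presheaf.stalk (jG z)),
      Ideal.span (Set.range c) = stalkIdeal (𝓔 ⊔ 𝒦) (jG z) ∧ IsQuasiRegular c := by
    intro z hz
    have hzC : jG z ∈ ((𝓔 ⊔ 𝒦).support : Set X) := by
      have h1 : z ∈ (((𝓔 ⊔ 𝒦).comap jG).support : Set G) := by rw [hCD, hsuppZ]; exact hz
      rw [Scheme.IdealSheafData.support_comap] at h1
      exact h1
    haveI : IsRegularLocalRing (X.presheaf.stalk (jG z)) := hXreg (jG z)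
    haveI : IsRegularLocalRing (X.presheaf.stalk (jG z) ⧸ stalkIdeal (𝓔 ⊔ 𝒦) (jG z)) := hCreg_pt _ hzC (hjsp z)
    obtain ⟨n, c, -, hc, hq, -⟩ := exists_isQuasiRegular_span_eq_of_isRegularLocalRing_quotient
      (J := stalkIdeal (𝓔 ⊔ 𝒦) (jG z)) ((mem_support_iff_stalkIdeal_le _ _).mp hzC) (stalkIdeal (𝓔 ⊔ 𝒦) (jG z) : Set _)
      (Ideal.span_eq _)
    exact ⟨n, c, hc, hq⟩
  have he1 : ((𝓔 ⊔ 𝒦).comap τ).comap j₂ = vanishingIdeal ⟨υ₂ ⁻¹' Z, hZ.preimage υ₂.continuous⟩ :=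
    comap_comap_eq_vanishingIdeal_preimage_of_model O k θ hθ (σ ≫ q) jG tG hsq (𝓔 ⊔ 𝒦) τ hτ j₂ t₂
      (by simpa only [Category.assoc] using hsq₂) υ₂ hcomm ⟨Z, hZ⟩ hCD hqr
  have he2 : ∀ z : X₂, (stalkIdeal ((𝓔 ⊔ 𝒦).comap τ) z).IsPrincipal := fun z => by
    obtain ⟨u, -, hu⟩ := hτ.isEffectiveCartier.exists_stalkIdeal_eq_span z
    exact ⟨⟨u, by rw [hu, Ideal.submodule_span_eq]⟩⟩
  have he3 : Scheme.IsRegular ((𝓔 ⊔ 𝒦).comap τ).subscheme := hτ.isRegular_subscheme_comap hXreg hCreg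
  have he4 : (τ ≫ σ) '' (((𝓔 ⊔ 𝒦).comap τ).support : Set X₂) ⊆ {p : P | ¬ IsGenericPoint p Y} := by
    rintro _ ⟨z, hz, rfl⟩
    rw [Scheme.IdealSheafData.support_comap] at hz
    exact hiv ⟨τ z, hz, rfl⟩
  have he5 : Ruled F₉ Z₉ hZ₉ F₁₀ υ' G' (υ₂ ≫ γ) (υ₂ ⁻¹' Z) X₂ (τ ≫ σ) j₂ ((𝓔 ⊔ 𝒦).comap τ) :=
    hRuledBorn X σ S jG tG 𝓔 𝒦 X₂ τ j₂ t₂ hCh inferInstance inferInstance hXreg hdom hsq hTS hCD hk_iii hCreg he_iii hτ hsq₂ hcomm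
  have hk1 : ∀ z : X₂, (stalkIdeal (strictTransformIdeal τ (𝓔 ⊔ 𝒦) 𝒦) z).IsPrincipal := fun z =>
    isPrincipal_stalkIdeal_strictTransformIdeal hXreg hCreg hτ hCne 𝒦 hk_i z
  have hKc : K = closure K := hKcl.closure_eq.symm
  have hk2 : ((strictTransformIdeal τ (𝓔 ⊔ 𝒦) 𝒦).comap j₂).comap (υ₂ ⁻¹ᵁ V).ι =
      (vanishingIdeal (⟨closure (closure (υ₂ ⁻¹' (K \ Z))), isClosed_closure⟩ : Closeds G')).comap (υ₂ ⁻¹ᵁ V).ι := by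
    have hdense : ((⟨closure K, isClosed_closure⟩ : Closeds G) : Set G) ∩ (V : Set G) ⊆
        closure (((⟨closure K, isClosed_closure⟩ : Closeds G) : Set G) \ (⟨Z, hZ⟩ : Closeds G)) := by
      intro x hx
      have hx1 : x ∈ K := by rw [hKc]; exact hx.1
      have hsub : K ⊆ closure (K \ Z) := hKE.trans (closure_mono fun x hx => ⟨hx.1, fun hxZ => hx.2 (hZE hxZ)⟩)
      change x ∈ closure (closure K \ Z)
      rw [← hKc]
      exact hsub hx1
    have h := coneRound_shadow_comap_loc 𝓔 𝒦 hk_v hτ hcart ⟨closure K, isClosed_closure⟩ ⟨Z, hZ⟩ V hk_ii hυ₂ hdense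
    rw [h]
    congr 2
    refine Closeds.ext ?_
    change closure (υ₂ ⁻¹' (closure K \ Z)) = closure (closure (υ₂ ⁻¹' (K \ Z)))
    rw [closure_closure, ← hKc]
  have hk3 : Flat ((((𝓔 ⊔ 𝒦).comap τ) ⊔ strictTransformIdeal τ (𝓔 ⊔ 𝒦) 𝒦).subschemeι ≫ (τ ≫ σ) ≫ q) := by
    have h := coneRound_flat 𝓔 𝒦 hk_v hτ (σ ≫ q) hk_iii
    simpa only [Category.assoc] using h
  have hk4reg : Scheme.IsRegular (((𝓔 ⊔ 𝒦).comap τ) ⊔ strictTransformIdeal τ (𝓔 ⊔ 𝒦) 𝒦).subscheme :=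
    coneRound_isRegular 𝓔 𝒦 hk_v hτ hCreg
  have hk4 : ∀ (E'' : Set G') (hE'' : IsClosed E'') (K'' : Set G') (y : G'),
      j₂ y ∈ ((((𝓔 ⊔ 𝒦).comap τ) ⊔ strictTransformIdeal τ (𝓔 ⊔ 𝒦) 𝒦).support : Set X₂) →
      stalkIdeal (vanishingIdeal (⟨E'', hE''⟩ : Closeds G') ⊔
        vanishingIdeal (⟨closure K'', isClosed_closure⟩ : Closeds G')) y =
      stalkIdeal (vanishingIdeal (⟨E'' ∩ closure K'', hE''.inter isClosed_closure⟩ : Closeds G')) y →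
      IsRegularLocalRing (X₂.presheaf.stalk (j₂ y) ⧸
        stalkIdeal (((𝓔 ⊔ 𝒦).comap τ) ⊔ strictTransformIdeal τ (𝓔 ⊔ 𝒦) 𝒦) (j₂ y)) := by
    intro E'' hE'' K'' y hy _
    obtain ⟨s, hs⟩ : j₂ y ∈ Set.range (((𝓔 ⊔ 𝒦).comap τ) ⊔ strictTransformIdeal τ (𝓔 ⊔ 𝒦) 𝒦).subschemeι := by
      rw [Scheme.IdealSheafData.range_subschemeι]; exact hy
    have h := (isRegularLocalRing_stalk_subscheme_iff _ s).mp (hk4reg s)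
    rw [show (((𝓔 ⊔ 𝒦).comap τ) ⊔ strictTransformIdeal τ (𝓔 ⊔ 𝒦) 𝒦).subschemeι.base s = j₂ y from hs] at h
    exact h
  have hk5 : IsEffectiveCartier (((𝓔 ⊔ 𝒦).comap τ).comap (strictTransformIdeal τ (𝓔 ⊔ 𝒦) 𝒦).subschemeι) :=
    isEffectiveCartier_cone_next 𝓔 𝒦 hτ
  have hKne' : 𝒦 ≠ ⊥ := by
    intro hK0
    have hVK : (V : Set G) ⊆ closure K := fun x hx =>
      (mem_support_iff_mem_closure_of_comap_ι_eq jG 𝒦 K V hk_ii hx).mp (by rw [hK0, Scheme.IdealSheafData.support_bot]; trivial)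
    obtain ⟨z, hz⟩ := hZne
    have hVne : (V : Set G).Nonempty := ⟨z, hEV (hZE hz)⟩
    have hdenseV : Dense (V : Set G) := V.2.dense hVne
    apply hKne
    rw [hKc]
    exact Set.eq_univ_of_univ_subset ((hdenseV.closure_eq ▸ closure_minimal hVK isClosed_closure :
      (Set.univ : Set G) ⊆ closure K))
  have hStne : strictTransformIdeal τ (𝓔 ⊔ 𝒦) 𝒦 ≠ ⊥ := by
    intro h0
    have hle : 𝒦.comap τ ≤ strictTransformIdeal τ (𝓔 ⊔ 𝒦) 𝒦 := comap_le_strictTransformIdeal τ (𝓔 ⊔ 𝒦) 𝒦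
    rw [h0, le_bot_iff] at hle
    apply stalkIdeal_ne_bot_of_ne_bot hKne' (τ (j₂ t'))
    have h3 : stalkIdeal (𝒦.comap τ) (j₂ t') = ⊥ := by rw [hle, stalkIdeal_bot]
    rw [stalkIdeal_comap_eq_map_stalkMap] at h3
    exact (Ideal.map_eq_bot_iff_of_injective (hτ.stalkMap_injective (j₂ t'))).mp h3
  have hk6 : IsEffectiveCartier ((strictTransformIdeal τ (𝓔 ⊔ 𝒦) 𝒦).comap ((𝓔 ⊔ 𝒦).comap τ).subschemeι) :=
    isEffectiveCartier_comap_subschemeι_swap ((𝓔 ⊔ 𝒦).comap τ) (strictTransformIdeal τ (𝓔 ⊔ 𝒦) 𝒦) he2 hk1 he3 hStne hk5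
  have hExcNew : ∀ hE' : IsClosed (υ₂ ⁻¹' Z),
      Tower.Exc₃ O P q Y Ruled Z₉ hZ₉ υ' G' (υ₂ ≫ γ) (υ₂ ⁻¹' Z) hE' K' X₂ (τ ≫ σ) j₂ := by
    intro hE'
    refine Or.inr ⟨(𝓔 ⊔ 𝒦).comap τ, he1, he2, he3, he4, he5, ?_⟩
    rcases hK' with hK0 | hKst
    · exact Or.inl hK0
    · subst hKst
      exact Or.inr ⟨_, hk1, ⟨υ₂ ⁻¹ᵁ V, Set.preimage_mono (hZE.trans hEV), hk2⟩, hk3, hk4 _ _ _, hk5, hk6⟩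
  -- ============ (ii) the OLD surface `𝓔'' := St_𝒞 𝓔` (disjoint from `St 𝒦`) ============
  have hEc : ((⟨E, hE⟩ : Closeds G) : Set G) ⊆ closure (((⟨E, hE⟩ : Closeds G) : Set G) \ (⟨Z, hZ⟩ : Closeds G)) := hEZ
  have ho1 : (strictTransformIdeal τ (𝓔 ⊔ 𝒦) 𝓔).comap j₂ =
      vanishingIdeal (⟨closure (υ₂ ⁻¹' (E \ Z)), isClosed_closure⟩ : Closeds G') :=
    coneRound_exceptional_comap 𝓔 𝒦 hk_vi hτ hcart ⟨E, hE⟩ ⟨Z, hZ⟩ he_i hυ₂ hEc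
  have ho2 : ∀ z : X₂, (stalkIdeal (strictTransformIdeal τ (𝓔 ⊔ 𝒦) 𝓔) z).IsPrincipal := fun z =>
    isPrincipal_stalkIdeal_strictTransformIdeal hXreg hCreg hτ hCne 𝓔 he_ii z
  obtain ⟨e𝓔, he𝓔⟩ := exists_iso_subscheme_strictTransformIdeal_exceptional 𝓔 𝒦 hk_vi hτ
  have ho3 : Scheme.IsRegular (strictTransformIdeal τ (𝓔 ⊔ 𝒦) 𝓔).subscheme :=
    Scheme.IsRegular.of_isOpenImmersion e𝓔.hom he_iii
  have ho4 : (τ ≫ σ) '' ((strictTransformIdeal τ (𝓔 ⊔ 𝒦) 𝓔).support : Set X₂) ⊆ {p : P | ¬ IsGenericPoint p Y} := by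
    rintro _ ⟨z, hz, rfl⟩
    have hz' : z ∈ ((𝓔.comap τ).support : Set X₂) :=
      Scheme.IdealSheafData.support_antitone (comap_le_strictTransformIdeal τ (𝓔 ⊔ 𝒦) 𝓔) hz
    rw [Scheme.IdealSheafData.support_comap] at hz'
    exact he_iv ⟨τ z, hz', rfl⟩
  have ho5 : Ruled F₉ Z₉ hZ₉ F₁₀ υ' G' (υ₂ ≫ γ) (closure (υ₂ ⁻¹' (E \ Z))) X₂ (τ ≫ σ) j₂ (strictTransformIdeal τ (𝓔 ⊔ 𝒦) 𝓔) :=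
    hRuledIso G G' γ _ E _ X X₂ σ jG j₂ 𝓔 _ τ ⟨e𝓔, he𝓔⟩ he_v
  have hsep : strictTransformIdeal τ (𝓔 ⊔ 𝒦) 𝓔 ⊔ strictTransformIdeal τ (𝓔 ⊔ 𝒦) 𝒦 = ⊤ :=
    strictTransformIdeal_sup_strictTransformIdeal_eq_top τ 𝓔 𝒦 hτ he_ii hk_i
  haveI hempty : IsEmpty (strictTransformIdeal τ (𝓔 ⊔ 𝒦) 𝓔 ⊔ strictTransformIdeal τ (𝓔 ⊔ 𝒦) 𝒦).subscheme := by
    rw [← (Scheme.IdealSheafData.subschemeι _).ker_eq_top_iff_isEmpty, Scheme.IdealSheafData.ker_subschemeι]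
    exact hsep
  have hok3 : Flat ((strictTransformIdeal τ (𝓔 ⊔ 𝒦) 𝓔 ⊔ strictTransformIdeal τ (𝓔 ⊔ 𝒦) 𝒦).subschemeι ≫ (τ ≫ σ) ≫ q) :=
    inferInstance
  have hok4 : ∀ (E'' : Set G') (hE'' : IsClosed E'') (K'' : Set G') (y : G'),
      j₂ y ∈ ((strictTransformIdeal τ (𝓔 ⊔ 𝒦) 𝓔 ⊔ strictTransformIdeal τ (𝓔 ⊔ 𝒦) 𝒦).support : Set X₂) →
      stalkIdeal (vanishingIdeal (⟨E'', hE''⟩ : Closeds G') ⊔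
        vanishingIdeal (⟨closure K'', isClosed_closure⟩ : Closeds G')) y =
      stalkIdeal (vanishingIdeal (⟨E'' ∩ closure K'', hE''.inter isClosed_closure⟩ : Closeds G')) y →
      IsRegularLocalRing (X₂.presheaf.stalk (j₂ y) ⧸
        stalkIdeal (strictTransformIdeal τ (𝓔 ⊔ 𝒦) 𝓔 ⊔ strictTransformIdeal τ (𝓔 ⊔ 𝒦) 𝒦) (j₂ y)) := by
    intro E'' hE'' K'' y hy _
    rw [hsep, Scheme.IdealSheafData.support_top] at hy
    exact absurd hy (by simp)
  have hcomap_top : ∀ (I J : X₂.IdealSheafData), I ⊔ J = ⊤ → I.comap J.subschemeι = ⊤ := by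
    intro I J hIJ
    rw [← Scheme.IdealSheafData.support_eq_bot_iff, eq_bot_iff]
    intro s hs
    rw [Scheme.IdealSheafData.support_comap] at hs
    have h1 : J.subschemeι s ∈ (J.support : Set X₂) := by
      rw [← Scheme.IdealSheafData.range_subschemeι]; exact ⟨s, rfl⟩
    have h2 : J.subschemeι s ∈ ((I ⊔ J).support : Set X₂) := by
      rw [Scheme.IdealSheafData.support_sup]; exact ⟨hs, h1⟩
    rw [hIJ, Scheme.IdealSheafData.support_top] at h2
    exact absurd h2 (by simp)
  have hok5 : IsEffectiveCartier ((strictTransformIdeal τ (𝓔 ⊔ 𝒦) 𝓔).comap (strictTransformIdeal τ (𝓔 ⊔ 𝒦) 𝒦).subschemeι) := by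
    rw [hcomap_top _ _ hsep]; exact isEffectiveCartier_top
  have hok6 : IsEffectiveCartier ((strictTransformIdeal τ (𝓔 ⊔ 𝒦) 𝒦).comap (strictTransformIdeal τ (𝓔 ⊔ 𝒦) 𝓔).subschemeι) := by
    rw [hcomap_top _ _ (by rw [sup_comm]; exact hsep)]; exact isEffectiveCartier_top
  have hExcOld : ∀ hE' : IsClosed (closure (υ₂ ⁻¹' (E \ Z))),
      Tower.Exc₃ O P q Y Ruled Z₉ hZ₉ υ' G' (υ₂ ≫ γ) (closure (υ₂ ⁻¹' (E \ Z))) hE' K' X₂ (τ ≫ σ) j₂ := by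
    intro hE'
    refine Or.inr ⟨strictTransformIdeal τ (𝓔 ⊔ 𝒦) 𝓔, ho1, ho2, ho3, ho4, ho5, ?_⟩
    rcases hK' with hK0 | hKst
    · exact Or.inl hK0
    · subst hKst
      exact Or.inr ⟨_, hk1, ⟨υ₂ ⁻¹ᵁ V, (closure_minimal (Set.preimage_mono fun x hx => hx.1) (hE.preimage υ₂.continuous)).trans
        (Set.preimage_mono hEV), hk2⟩, hok3, hok4 _ _ _, hok5, hok6⟩
  have hExcOld₀ : ∀ hE' : IsClosed (closure (υ₂ ⁻¹' (E \ Z))),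
      Tower.Exc₃ O P q Y Ruled Z₉ hZ₉ υ' G' (υ₂ ≫ γ) (closure (υ₂ ⁻¹' (E \ Z))) hE' ∅ X₂ (τ ≫ σ) j₂ :=
    fun hE' => Tower.exc₃_forgetShadow O P q Y Ruled (hExcOld hE')
  -- ============ (iii) the retained list ============
  have hRuledAway : ∀ (F : Set G) (𝓕 : X.IdealSheafData),
      (∃ e : (𝓕.comap τ).subscheme ≅ 𝓕.subscheme, e.hom ≫ 𝓕.subschemeι = (𝓕.comap τ).subschemeι ≫ τ) →
      Ruled F₉ Z₉ hZ₉ F₁₀ υ' G γ F X σ jG 𝓕 →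
      Ruled F₉ Z₉ hZ₉ F₁₀ υ' G' (υ₂ ≫ γ) (closure (υ₂ ⁻¹' (F \ Z))) X₂ (τ ≫ σ) j₂ (𝓕.comap τ) :=
    fun F 𝓕 he hR => hRuledIso G G' γ _ F _ X X₂ σ jG j₂ 𝓕 _ τ he hR
  have hEs'B : ∀ F' ∈ Es', IsClosed F' ∧ ¬ closure (υ₂ ⁻¹' (T \ Z)) ⊆ F' := by
    intro F' hF'
    obtain ⟨F, hFmem, ⟨hrule, rfl⟩⟩ := hEs' F' hF'
    obtain ⟨hF, hTF, -⟩ := hCand F hFmem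
    exact ⟨isClosed_closure, not_closure_preimage_diff_subset hυ₂ hTirr hF hZ hTF hTZ hsuppZ.le⟩
  have hEs'Exc : ∀ F' ∈ Es', ∀ hF' : IsClosed F',
      Tower.Exc₃ O P q Y Ruled Z₉ hZ₉ υ' G' (υ₂ ≫ γ) F' hF' ∅ X₂ (τ ≫ σ) j₂ := by
    intro F' hF'
    obtain ⟨F, hFmem, ⟨hrule, rfl⟩⟩ := hEs' F' hF'
    rcases hrule with rfl | hdisjZF
    · exact hExcOld₀
    · obtain ⟨hF, -, hExcF0⟩ := hCand F hFmem
      refine Tower.exc₃_transport_away O P q Y Ruled hτ hυ₂ hsuppZ hcomm hRuledAway hF hExcF0 (Or.inr ⟨hdisjZF, fun 𝓕 h𝓕 => ?_⟩)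
      exact disjoint_support_centre_of_trace (σ ≫ q) (𝓔 ⊔ 𝒦) 𝓕 hF hCDpts h𝓕 hdisjZF
  -- ============ assemble ============
  rcases hE' with rfl | rfl
  · exact ⟨hυ', hZinf, hF₂, isClosed_closure, hirr, hZ.preimage υ₂.continuous, hTEnew, hEs'B, X₂, τ ≫ σ, _, j₂, t₂, hCh₂, hint₂,
      hnoeth₂, hreg₂, hdom₂, hsq₂, rfl, hExcNew, hEs'Exc⟩
  · exact ⟨hυ', hZinf, hF₂, isClosed_closure, hirr, isClosed_closure, hTEold, hEs'B, X₂, τ ≫ σ, _, j₂, t₂, hCh₂, hint₂,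
      hnoeth₂, hreg₂, hdom₂, hsq₂, rfl, hExcOld, hEs'Exc⟩

end Summit.ResolutionOfSingularities.ResolutionOfSingularities.Cruxes.EquisingularLiftNat.Sections

end
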